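import Summits.CriticalPhenomena.PercolationContinuityZ3.Theorems.Transplant.SharpnessGridWedge
import Summits.CriticalPhenomena.PercolationContinuityZ3.Theorems.Transplant.SharpnessGridWalks
import HarnessLib

/-!
# Transplant sharpness XXXVII — the gridded wedge is one-ended (connected at infinity)

builds on p205010 (kernel theorem, internal audit signed; external expert review pending).
Status sentence (coordinator 2026-08-20T04:30Z): "θ(p_c) = 0 on ℤ^d, all d ≥ 2 — kernel-verified (Lean 4/Mathlib,
standard axioms); internal adversarial audit SIGNED 2026-08-20 04:29Z; external expert review pending."

Lane `prim-bschramm`, seat p5 (sharpness); memo `run/shared/lean/prim/bschramm/P5-SHARPNESS.md` §2 row 83 (column "one-ended").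
ONE END in the combinatorial form: after deleting ANY finite set `K` of lattice points, all vertices of `G′_M = ℤ²[W ∪ L_M]` outside
the box `Λ_{R₀}` containing `K` lie in ONE connected component of `G′_M − K` (so the locally finite connected infinite graph
`G′_M` has exactly one end).  Route: a far vertex walks to a vertical grid line (inside the wedge, to the right), then away
from the box along that line to the row `±T`, along it to the column `T`, and up to the corner `(T, T)` (`T = M (R₀ + 1)`),
never entering `Λ_{R₀} ⊇ K`.  PROVED:

* `supBound K` (`R₀`), `abs_le_supBound`, `not_mem_of_far`; `gridWedgeMinus a b M K = gridWedge a b M ∖ K`;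
* `reach_col`, `reach_row`, `reach_wedge_row` — straight walks in `ℤ²[G′ ∖ K]` (`SharpnessGridWalks.exists_walk_col/row`);
* `reach_corner` — every far vertex of `G′ ∖ K` reaches `(T, T)`;
* `gridWedge_connected_at_infinity` — **any two far vertices are joined in `G′_M − K`** (`a, b ≥ 0`, `M ≥ 1`).

References: I. Benjamini, O. Schramm (1996), §2; G. Grimmett, *Percolation* (1999), §11.5.
-/

noncomputable section

namespace Summit.CriticalPhenomena.PercolationContinuityZ3.Theorems.TransplantSharpness

open Literature.Probability.LatticeModels Literature.Barriers.CriticalPhenomena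

/-! ## A box containing the deleted set -/

/-- `R₀(K)`: a sup-norm radius of a box containing the finite set `K`. House notation. -/
def supBound (K : Finset (Site 2)) : ℕ := K.sup fun z => max (z 0).natAbs (z 1).natAbs

/-- Points of `K` have both coordinates of modulus `≤ R₀`. [folklore] -/
theorem abs_le_supBound {K : Finset (Site 2)} {z : Site 2} (hz : z ∈ K) :
    |z 0| ≤ (supBound K : ℤ) ∧ |z 1| ≤ (supBound K : ℤ) := by
  have h := Finset.le_sup (f := fun z : Site 2 => max (z 0).natAbs (z 1).natAbs) hz
  have h0 : (z 0).natAbs ≤ supBound K := le_trans (le_max_left _ _) h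
  have h1 : (z 1).natAbs ≤ supBound K := le_trans (le_max_right _ _) h
  constructor
  · rw [← Int.natCast_natAbs]; exact_mod_cast h0
  · rw [← Int.natCast_natAbs]; exact_mod_cast h1

/-- A point with a coordinate of modulus `> R₀` is not in `K`. [folklore] -/
theorem not_mem_of_far {K : Finset (Site 2)} {z : Site 2}
    (h : (supBound K : ℤ) < |z 0| ∨ (supBound K : ℤ) < |z 1|) : z ∉ K := by
  intro hz
  obtain ⟨h0, h1⟩ := abs_le_supBound hz
  rcases h with h | h <;> linarith

variable {a b : ℝ} {M : ℕ} {K : Finset (Site 2)}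

/-- The gridded wedge with the finite set `K` deleted. House notation. -/
def gridWedgeMinus (a b : ℝ) (M : ℕ) (K : Finset (Site 2)) : Set (Site 2) := gridWedge a b M \ ↑K

/-- A far grid-line point lies in the cut graph. [folklore] -/
theorem mem_gridWedgeMinus_of_grid {z : Site 2} (hz : (M : ℤ) ∣ z 0 ∨ (M : ℤ) ∣ z 1)
    (hfar : (supBound K : ℤ) < |z 0| ∨ (supBound K : ℤ) < |z 1|) : z ∈ gridWedgeMinus a b M K :=
  ⟨gridLines_subset_gridWedge a b M hz, fun h => not_mem_of_far hfar (Finset.mem_coe.1 h)⟩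

/-- A far wedge point lies in the cut graph. [folklore] -/
theorem mem_gridWedgeMinus_of_wedge {z : Site 2} (hz : z ∈ logWedge a b)
    (hfar : (supBound K : ℤ) < |z 0| ∨ (supBound K : ℤ) < |z 1|) : z ∈ gridWedgeMinus a b M K :=
  ⟨logWedge_subset_gridWedge a b M hz, fun h => not_mem_of_far hfar (Finset.mem_coe.1 h)⟩

/-! ## Straight walks avoiding the box -/

/-- A vertical segment of the grid line `x₀ = c` whose points are far lies in `ℤ²[G′ ∖ K]`. [folklore] -/
theorem reach_col {c j j' : ℤ} (hc : (M : ℤ) ∣ c)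
    (h : ∀ t : ℤ, min j j' ≤ t → t ≤ max j j' → (supBound K : ℤ) < |c| ∨ (supBound K : ℤ) < |t|)
    (hx : (![c, j] : Site 2) ∈ gridWedgeMinus a b M K) (hy : (![c, j'] : Site 2) ∈ gridWedgeMinus a b M K) :
    ((zdGraph 2).induce (gridWedgeMinus a b M K)).Reachable ⟨![c, j], hx⟩ ⟨![c, j'], hy⟩ := by
  obtain ⟨w, -⟩ := exists_walk_col (S := gridWedgeMinus a b M K) (i := c) (j := j) (j' := j')
    (fun t ht1 ht2 => mem_gridWedgeMinus_of_grid (Or.inl (by simpa using hc)) (by simpa using h t ht1 ht2)) hx hy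
  exact ⟨w⟩

/-- A horizontal segment of the grid line `x₁ = j` whose points are far lies in `ℤ²[G′ ∖ K]`. [folklore] -/
theorem reach_row {i i' j : ℤ} (hj : (M : ℤ) ∣ j)
    (h : ∀ t : ℤ, min i i' ≤ t → t ≤ max i i' → (supBound K : ℤ) < |t| ∨ (supBound K : ℤ) < |j|)
    (hx : (![i, j] : Site 2) ∈ gridWedgeMinus a b M K) (hy : (![i', j] : Site 2) ∈ gridWedgeMinus a b M K) :
    ((zdGraph 2).induce (gridWedgeMinus a b M K)).Reachable ⟨![i, j], hx⟩ ⟨![i', j], hy⟩ := by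
  obtain ⟨w, -⟩ := exists_walk_row (S := gridWedgeMinus a b M K) (i := i) (i' := i') (j := j)
    (fun t ht1 ht2 => mem_gridWedgeMinus_of_grid (Or.inr (by simpa using hj)) (by simpa using h t ht1 ht2)) hx hy
  exact ⟨w⟩

/-- A rightward wedge row segment whose points are far lies in `ℤ²[G′ ∖ K]` (`a, b ≥ 0`). [folklore] -/
theorem reach_wedge_row (ha : 0 ≤ a) (hb : 0 ≤ b) {i i' j : ℤ} (hW : (![i, j] : Site 2) ∈ logWedge a b) (hii' : i ≤ i')
    (h : ∀ t : ℤ, i ≤ t → t ≤ i' → (supBound K : ℤ) < |t| ∨ (supBound K : ℤ) < |j|)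
    (hx : (![i, j] : Site 2) ∈ gridWedgeMinus a b M K) (hy : (![i', j] : Site 2) ∈ gridWedgeMinus a b M K) :
    ((zdGraph 2).induce (gridWedgeMinus a b M K)).Reachable ⟨![i, j], hx⟩ ⟨![i', j], hy⟩ := by
  obtain ⟨w, -⟩ := exists_walk_row (S := gridWedgeMinus a b M K) (i := i) (i' := i') (j := j)
    (fun t ht1 ht2 => by
      rw [min_eq_left hii'] at ht1; rw [max_eq_right hii'] at ht2
      exact mem_gridWedgeMinus_of_wedge (row_right_mem_logWedge ha hb hW ht1) (by simpa using h t ht1 ht2)) hx hy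
  exact ⟨w⟩

/-! ## From a vertical grid line to the far corner -/

/-- The corner `(T, T)`, `T := M (R₀ + 1)`: a grid crossing outside the box. House notation. -/
def cornerT (M : ℕ) (K : Finset (Site 2)) : ℤ := (M : ℤ) * ((supBound K : ℤ) + 1)

/-- `M ∣ T` and `R₀ < T` (`M ≥ 1`). [folklore] -/
theorem cornerT_facts (hM : 1 ≤ M) : (M : ℤ) ∣ cornerT M K ∧ (supBound K : ℤ) < cornerT M K := by
  have hM' : (1 : ℤ) ≤ M := by exact_mod_cast hM
  have hR : (0 : ℤ) ≤ supBound K := Nat.cast_nonneg _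
  refine ⟨dvd_mul_right _ _, ?_⟩
  unfold cornerT
  nlinarith

/-- The corner lies in the cut graph. [folklore] -/
theorem corner_mem_gridWedgeMinus (hM : 1 ≤ M) : (![cornerT M K, cornerT M K] : Site 2) ∈ gridWedgeMinus a b M K := by
  obtain ⟨hd, hT⟩ := cornerT_facts (K := K) hM
  exact mem_gridWedgeMinus_of_grid (Or.inl (by simpa using hd)) (Or.inl (by simp; rw [abs_of_pos (by linarith)]; exact hT))

/-- **From a far point of a vertical grid line to the corner**, avoiding the box: up/down the line to the row `±T`, along
that row to the column `T`, then along the column `T`. [folklore] -/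
theorem reach_corner_of_col (hM : 1 ≤ M) {c j : ℤ} (hc : (M : ℤ) ∣ c)
    (hfar : (supBound K : ℤ) < |c| ∨ (supBound K : ℤ) < |j|) (hx : (![c, j] : Site 2) ∈ gridWedgeMinus a b M K) :
    ((zdGraph 2).induce (gridWedgeMinus a b M K)).Reachable ⟨![c, j], hx⟩ ⟨![cornerT M K, cornerT M K], corner_mem_gridWedgeMinus hM⟩ := by
  obtain ⟨hdT, hT⟩ := cornerT_facts (K := K) hM
  set T := cornerT M K with hTdef
  set R₀ : ℤ := (supBound K : ℤ) with hR₀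
  have hR0 : 0 ≤ R₀ := Nat.cast_nonneg _
  have hTpos : 0 < T := by linarith
  have habsT : R₀ < |T| := by rw [abs_of_pos hTpos]; exact hT
  have habsnT : R₀ < |(-T)| := by rw [abs_neg, abs_of_pos hTpos]; exact hT
  -- the target row `j₂ = ±T`
  set j₂ : ℤ := if 0 ≤ j then T else -T with hj₂
  have hj₂abs : R₀ < |j₂| := by rw [hj₂]; split_ifs <;> assumption
  have hj₂dvd : (M : ℤ) ∣ j₂ := by
    rw [hj₂]; split_ifs
    exacts [hdT, hdT.neg_right]
  have hq₂ : (![c, j₂] : Site 2) ∈ gridWedgeMinus a b M K := mem_gridWedgeMinus_of_grid (Or.inl (by simpa using hc)) (Or.inr (by simpa using hj₂abs))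
  have hq₃ : (![T, j₂] : Site 2) ∈ gridWedgeMinus a b M K := mem_gridWedgeMinus_of_grid (Or.inl (by simpa using hdT)) (Or.inl (by simpa using habsT))
  -- (2) along the column `c` from `j` to `j₂`
  have s2 : ((zdGraph 2).induce (gridWedgeMinus a b M K)).Reachable ⟨![c, j], hx⟩ ⟨![c, j₂], hq₂⟩ := by
    refine reach_col hc (fun t ht1 ht2 => ?_) hx hq₂
    rcases hfar with hfar | hfar
    · exact Or.inl hfar
    · right
      rw [hj₂] at ht1 ht2
      split_ifs at ht1 ht2 with hj0
      · rw [abs_of_nonneg hj0] at hfar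
        have : R₀ < t := by
          rcases le_total j T with hjT | hjT
          · rw [min_eq_left hjT] at ht1; linarith
          · rw [min_eq_right hjT] at ht1; linarith
        rw [abs_of_pos (by linarith)]; exact this
      · push Not at hj0
        rw [abs_of_neg hj0] at hfar
        have : t < -R₀ := by
          rcases le_total j (-T) with hjT | hjT
          · rw [max_eq_right hjT] at ht2; linarith
          · rw [max_eq_left hjT] at ht2; linarith
        rw [abs_of_neg (by linarith)]; linarith
  -- (3) along the row `j₂` from `c` to `T`
  have s3 : ((zdGraph 2).induce (gridWedgeMinus a b M K)).Reachable ⟨![c, j₂], hq₂⟩ ⟨![T, j₂], hq₃⟩ :=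
    reach_row hj₂dvd (fun t _ _ => Or.inr hj₂abs) hq₂ hq₃
  -- (4) along the column `T` from `j₂` to `T`
  have s4 : ((zdGraph 2).induce (gridWedgeMinus a b M K)).Reachable ⟨![T, j₂], hq₃⟩ ⟨![T, T], corner_mem_gridWedgeMinus hM⟩ :=
    reach_col hdT (fun t _ _ => Or.inl habsT) hq₃ (corner_mem_gridWedgeMinus hM)
  exact (s2.trans s3).trans s4

/-! ## Every far vertex reaches the corner -/

/-- **Every far vertex of `G′ ∖ K` reaches the corner `(T, T)` inside `G′ − K`** (`a, b ≥ 0`, `M ≥ 1`). [folklore] -/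
theorem reach_corner (ha : 0 ≤ a) (hb : 0 ≤ b) (hM : 1 ≤ M) {x : Site 2} (hxS : x ∈ gridWedge a b M)
    (hfar : (supBound K : ℤ) < |x 0| ∨ (supBound K : ℤ) < |x 1|) (hx : x ∈ gridWedgeMinus a b M K) :
    ((zdGraph 2).induce (gridWedgeMinus a b M K)).Reachable ⟨x, hx⟩ ⟨![cornerT M K, cornerT M K], corner_mem_gridWedgeMinus hM⟩ := by
  set R₀ : ℤ := (supBound K : ℤ) with hR₀
  have hM0 : (0 : ℤ) < M := by exact_mod_cast hM
  have ex : x = ![x 0, x 1] := by funext k; fin_cases k <;> rfl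
  have hx' : (![x 0, x 1] : Site 2) ∈ gridWedgeMinus a b M K := ex ▸ hx
  suffices H : ((zdGraph 2).induce (gridWedgeMinus a b M K)).Reachable ⟨![x 0, x 1], hx'⟩
      ⟨![cornerT M K, cornerT M K], corner_mem_gridWedgeMinus hM⟩ by
    have e : (⟨![x 0, x 1], hx'⟩ : gridWedgeMinus a b M K) = ⟨x, hx⟩ := Subtype.ext ex.symm
    rwa [e] at H
  by_cases h0 : (M : ℤ) ∣ x 0
  · -- on a vertical grid line already
    exact reach_corner_of_col hM h0 hfar hx'
  by_cases h1 : (M : ℤ) ∣ x 1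
  · -- on a horizontal grid line: move along it, away from the box, to a vertical grid line
    by_cases hs : 0 ≤ x 0
    · obtain ⟨hcd, hxc, hcx⟩ := ceilMul_bounds hM (x 0)
      set c : ℤ := (M : ℤ) * (x 0 / M) + M with hcdef
      have hcfar : R₀ < |c| ∨ R₀ < |x 1| := by
        rcases hfar with hfar | hfar
        · left; rw [abs_of_nonneg hs] at hfar; rw [abs_of_nonneg (by linarith)]; linarith
        · exact Or.inr hfar
      have hq : (![c, x 1] : Site 2) ∈ gridWedgeMinus a b M K := mem_gridWedgeMinus_of_grid (Or.inl (by simpa using hcd)) (by simpa using hcfar)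
      have s1 : ((zdGraph 2).induce (gridWedgeMinus a b M K)).Reachable ⟨![x 0, x 1], hx'⟩ ⟨![c, x 1], hq⟩ := by
        refine reach_row h1 (fun t ht1 _ => ?_) hx' hq
        rcases hfar with hfar | hfar
        · left; rw [abs_of_nonneg hs] at hfar
          rw [min_eq_left hxc] at ht1
          rw [abs_of_nonneg (by linarith)]; linarith
        · exact Or.inr hfar
      exact s1.trans (reach_corner_of_col hM hcd hcfar hq)
    · push Not at hs
      obtain ⟨hfd, hfx, hxf⟩ := floorMul_bounds hM (x 0)
      set c : ℤ := (M : ℤ) * (x 0 / M) with hcdef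
      have hcle : c ≤ x 0 := by linarith [hfx]
      have hcfar : R₀ < |c| ∨ R₀ < |x 1| := by
        rcases hfar with hfar | hfar
        · left; rw [abs_of_neg hs] at hfar; rw [abs_of_neg (by linarith)]; linarith
        · exact Or.inr hfar
      have hq : (![c, x 1] : Site 2) ∈ gridWedgeMinus a b M K := mem_gridWedgeMinus_of_grid (Or.inl (by simpa using hfd)) (by simpa using hcfar)
      have s1 : ((zdGraph 2).induce (gridWedgeMinus a b M K)).Reachable ⟨![x 0, x 1], hx'⟩ ⟨![c, x 1], hq⟩ := by
        refine reach_row h1 (fun t _ ht2 => ?_) hx' hq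
        rcases hfar with hfar | hfar
        · left; rw [abs_of_neg hs] at hfar
          rw [max_eq_left hcle] at ht2
          rw [abs_of_neg (by linarith)]; linarith
        · exact Or.inr hfar
      exact s1.trans (reach_corner_of_col hM hfd hcfar hq)
  · -- inside the wedge, on no grid line: move right to the next vertical grid line
    have hW : x ∈ logWedge a b := by
      rcases hxS with hW | hL
      · exact hW
      · exact absurd hL (fun h => h.elim h0 h1)
    have hW' : (![x 0, x 1] : Site 2) ∈ logWedge a b := ex ▸ hW
    obtain ⟨hx0, hx1, -⟩ := (vec_mem_logWedge_iff a b (x 0) (x 1)).1 hW'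
    obtain ⟨hcd, hxc, hcx⟩ := ceilMul_bounds hM (x 0)
    set c : ℤ := (M : ℤ) * (x 0 / M) + M with hcdef
    have hcfar : R₀ < |c| ∨ R₀ < |x 1| := by
      rcases hfar with hfar | hfar
      · left; rw [abs_of_nonneg hx0] at hfar; rw [abs_of_nonneg (by linarith)]; linarith
      · exact Or.inr hfar
    have hqW : (![c, x 1] : Site 2) ∈ logWedge a b := row_right_mem_logWedge ha hb hW' hxc
    have hq : (![c, x 1] : Site 2) ∈ gridWedgeMinus a b M K := mem_gridWedgeMinus_of_wedge hqW (by simpa using hcfar)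
    have s1 : ((zdGraph 2).induce (gridWedgeMinus a b M K)).Reachable ⟨![x 0, x 1], hx'⟩ ⟨![c, x 1], hq⟩ := by
      refine reach_wedge_row ha hb hW' hxc (fun t ht1 _ => ?_) hx' hq
      rcases hfar with hfar | hfar
      · left; rw [abs_of_nonneg hx0] at hfar; rw [abs_of_nonneg (by linarith)]; linarith
      · exact Or.inr hfar
    exact s1.trans (reach_corner_of_col hM hcd hcfar hq)

/-- **THE GRIDDED WEDGE IS CONNECTED AT INFINITY (one end).**  For every finite set `K` of lattice points, any two vertices
of `G′_M = ℤ²[logWedge a b ∪ gridLines M]` with a coordinate of modulus `> R₀(K)` lie in `G′_M ∖ K` and are joined by a walk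
of `G′_M` avoiding `K` (`a, b ≥ 0`, `M ≥ 1`).  So deleting finitely many vertices never leaves two infinite components: the
connected, locally finite, infinite graph `G′_M` has exactly one end (P5-SHARPNESS row 83, column "one-ended").
[cite: BenjaminiSchramm1996, §2 (ends of graphs)] -/
theorem gridWedge_connected_at_infinity (ha : 0 ≤ a) (hb : 0 ≤ b) (hM : 1 ≤ M) (K : Finset (Site 2))
    {x y : Site 2} (hxS : x ∈ gridWedge a b M) (hyS : y ∈ gridWedge a b M)
    (hxfar : (supBound K : ℤ) < |x 0| ∨ (supBound K : ℤ) < |x 1|)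
    (hyfar : (supBound K : ℤ) < |y 0| ∨ (supBound K : ℤ) < |y 1|) :
    ∃ (hx : x ∈ gridWedge a b M \ ↑K) (hy : y ∈ gridWedge a b M \ ↑K),
      ((zdGraph 2).induce (gridWedge a b M \ ↑K)).Reachable ⟨x, hx⟩ ⟨y, hy⟩ := by
  have hx : x ∈ gridWedgeMinus a b M K := ⟨hxS, fun h => not_mem_of_far hxfar (Finset.mem_coe.1 h)⟩
  have hy : y ∈ gridWedgeMinus a b M K := ⟨hyS, fun h => not_mem_of_far hyfar (Finset.mem_coe.1 h)⟩
  exact ⟨hx, hy, (reach_corner ha hb hM hxS hxfar hx).trans (reach_corner ha hb hM hyS hyfar hy).symm⟩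

end Summit.CriticalPhenomena.PercolationContinuityZ3.Theorems.TransplantSharpness

end
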